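import Summits.CriticalPhenomena.PercolationContinuityZ3.Theorems.Transplant.FKConnectivityAllQSPNegAssocPivot
import HarnessLib

/-!
# The Feder–Mihail induction for a hereditary class of events, and the free pivot of POSITIVE-THRESHOLD events (tools)

Support file (`--supports stmt-CriticalPhenomena-4575`), FK sub-lane `prim-bschramm-fk-2` (gen 10) of the post-continuity programme;
builds on p205010 (kernel theorem, internal audit signed; external expert review pending).  No named facts, no sorries, standard axioms.

WHAT IS PROVED (kernel; this file = the two tools, the negative-association theorems are in `FKConnectivityAllQSPNegAssocThreshold`).
The Feder–Mihail / Pemantle induction of `FK.negAssoc_of_edgeNegDep_of_pivot` (gen 9, p243077) needs the pivot property (ii) — "some pair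
of the support of `G` is nonnegatively correlated with `G`" — for EVERY increasing `G`; that is open.  (1) `FK.mass_negAssoc_of_edgeNegDep_of_pivotOn`:
the same induction with the pivot hypothesis restricted to any class `Q S G` of events closed under passing to the two sections at a pair of
`S`; the conclusion `S(F ∩ G)·Z ≤ S(F)·S(G)` then holds for the events of the class.  (2) `FK.exists_pivot_of_threshold`: (ii) is AUTOMATIC,
under every `φ_{w,q}` (only nonnegativity of the weights is used), for POSITIVE-THRESHOLD events — `θ ≤ Λ(ω) := ∑_{e ∈ S} λ_e 1_{e ∈ ω}` on
`G`, `Λ(ω) ≤ θ` off `G`, all `λ_e > 0` — because `∑_e λ_e·[S(J_e ∩ G)Z − S(G)S(J_e)] = S(1_G Λ)S(Gᶜ) − S(G)S(1_{Gᶜ}Λ) ≥ θS(G)S(Gᶜ) − θS(G)S(Gᶜ) = 0`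
(Feder–Mihail's own use is `Λ = |ω|`, constant on the support of a uniform matroid measure).  (3) `thresholdSum_insert/diff`: the sections
of a threshold event at `e ∈ S` are threshold events on `S ∖ e` for the same weights (thresholds `θ − λ_e`, `θ`), so the class is hereditary.
[cite: Pemantle2000, Thm. 1.3, §1.5 (pp. 1379–1380)] [cite: FederMihail1992, Lemma 3.2, §3] [cite: Grimmett2006, §3.9 (pp. 63–64)]
-/

noncomputable section

namespace Summit.CriticalPhenomena.PercolationContinuityZ3.Theorems

namespace FK

open MeasureTheory Set Literature.Probability.LatticeModels Literature.Probability.Percolation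
open Literature.Probability.Percolation.DecisionTree (ind ind_of_mem ind_of_not_mem ind_nonneg)
open scoped Classical symmDiff

variable {V : Type*} [Fintype V]

/-! ### The Feder–Mihail induction with the pivot hypothesis restricted to a hereditary class of events -/

/-- **Feder–Mihail's induction in mass form, for a hereditary class `Q` of events.**  As `FK.mass_negAssoc_of_edgeNegDep_of_pivot`, but the
pivot property is only assumed for the events `G` with `Q S G`, where `Q` is closed under passing to the two sections at any pair of `S`;
the conclusion `S_w(F ∩ G)·Z_w ≤ S_w(F)·S_w(G)` is obtained for those `G`.  (Induction on `|S|`, conditioning on the pivot pair; the cross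
term `(S₀(F)Z₁ − S₁(F)Z₀)(S₁(G)Z₀ − S₀(G)Z₁) ≥ 0` comes from (CD) and the pivot.)
[cite: Pemantle2000, Thm. 1.3, §1.5] [cite: FederMihail1992, §3] -/
theorem mass_negAssoc_of_edgeNegDep_of_pivotOn {q : ℝ} (hq : 0 < q) (P : (Sym2 V → unitInterval) → Prop)
    (Q : Finset (Sym2 V) → Set (BondConfig V) → Prop)
    (hP0 : ∀ (w : Sym2 V → unitInterval) (e : Sym2 V), P w → P (Function.update w e 0))
    (hP1 : ∀ (w : Sym2 V → unitInterval) (e : Sym2 V), P w → ((w e : unitInterval) : ℝ) ≠ 0 → P (Function.update w e 1))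
    (hQ0 : ∀ (S : Finset (Sym2 V)) (G : Set (BondConfig V)) (e : Sym2 V), e ∈ S → Q S G → Q (S.erase e) {ω | ω \ {e} ∈ G})
    (hQ1 : ∀ (S : Finset (Sym2 V)) (G : Set (BondConfig V)) (e : Sym2 V), e ∈ S → Q S G → Q (S.erase e) {ω | insert e ω ∈ G})
    (hCD : ∀ w : Sym2 V → unitInterval, P w → ∀ (e : Sym2 V) (F : Set (BondConfig V)), IsUpperSet F →
      (∀ ω : BondConfig V, ω ∆ {e} ∈ F ↔ ω ∈ F) →
      (∑ ω : BondConfig V, rcWeightW w q ∅ ω * ind ({ω | e ∈ ω} ∩ F) ω) * rcPartitionFunctionW w q ∅ ≤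
        (∑ ω : BondConfig V, rcWeightW w q ∅ ω * ind {ω | e ∈ ω} ω) * (∑ ω : BondConfig V, rcWeightW w q ∅ ω * ind F ω))
    (hpiv : ∀ w : Sym2 V → unitInterval, P w → ∀ (S : Finset (Sym2 V)) (G : Set (BondConfig V)), S.Nonempty → IsUpperSet G →
      DeterminedBy G ↑S → Q S G → ∃ e ∈ S,
        (∑ ω : BondConfig V, rcWeightW w q ∅ ω * ind G ω) * (∑ ω : BondConfig V, rcWeightW w q ∅ ω * ind {ω | e ∈ ω} ω) ≤
          (∑ ω : BondConfig V, rcWeightW w q ∅ ω * ind ({ω | e ∈ ω} ∩ G) ω) * rcPartitionFunctionW w q ∅)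
    {T : Finset (Sym2 V)} {F : Set (BondConfig V)} (hF : IsUpperSet F) (hFT : DeterminedBy F ↑T) (n : ℕ) :
    ∀ (S : Finset (Sym2 V)), S.card ≤ n → Disjoint S T → ∀ (w : Sym2 V → unitInterval), P w →
      ∀ G : Set (BondConfig V), IsUpperSet G → DeterminedBy G ↑S → Q S G →
        (∑ ω : BondConfig V, rcWeightW w q ∅ ω * ind (F ∩ G) ω) * rcPartitionFunctionW w q ∅ ≤
          (∑ ω : BondConfig V, rcWeightW w q ∅ ω * ind F ω) * (∑ ω : BondConfig V, rcWeightW w q ∅ ω * ind G ω) := by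
  -- adapted from `FK.mass_negAssoc_of_edgeNegDep_of_pivot` (same lane, gen 9): the class `Q` is threaded through the induction
  induction n with
  | zero =>
    intro S hS _ w _ G _ hGS _
    have hS0 : S = ∅ := Finset.card_eq_zero.1 (Nat.le_zero.1 hS)
    subst hS0
    have hG0 : DeterminedBy G (∅ : Set (Sym2 V)) := by simpa using hGS
    by_cases hmem : (∅ : BondConfig V) ∈ G
    · have hGu : G = Set.univ := Set.eq_univ_of_forall fun ω => (mem_iff_empty_mem_of_determinedBy_empty hG0 ω).2 hmem
      rw [hGu, Set.inter_univ, sum_rcWeightW_ind_univ]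
    · have hGe : G = ∅ := Set.eq_empty_of_forall_notMem fun ω h => hmem ((mem_iff_empty_mem_of_determinedBy_empty hG0 ω).1 h)
      rw [hGe, Set.inter_empty]
      have h0 : ∑ ω : BondConfig V, rcWeightW w q ∅ ω * ind (∅ : Set (BondConfig V)) ω = 0 :=
        Finset.sum_eq_zero fun ω _ => by rw [ind_of_not_mem (Set.notMem_empty ω), mul_zero]
      rw [h0, zero_mul, mul_zero]
  | succ n ih =>
    intro S hS hST w hw G hG hGS hGQ
    by_cases hSn : S.card ≤ n
    · exact ih S hSn hST w hw G hG hGS hGQ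
    have hSne : S.Nonempty := by rw [← Finset.card_pos]; omega
    obtain ⟨e, heS, hpe⟩ := hpiv w hw S G hSne hG hGS hGQ
    have heT : e ∉ (↑T : Set (Sym2 V)) := fun h => Finset.disjoint_left.1 hST heS (by simpa using h)
    have hFe : ∀ ω : BondConfig V, ω ∆ {e} ∈ F ↔ ω ∈ F := symmDiff_singleton_mem_iff_of_determinedBy hFT heT
    have hcd := hCD w hw e F hF hFe
    set S' := S.erase e with hS'
    have hS'c : S'.card ≤ n := by rw [hS', Finset.card_erase_of_mem heS]; omega
    have hS'T : Disjoint S' T := Finset.disjoint_of_subset_left (Finset.erase_subset e S) hST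
    set w0 := Function.update w e 0 with hw0
    set w1 := Function.update w e 1 with hw1
    set G0 : Set (BondConfig V) := {ω | ω \ {e} ∈ G} with hG0d
    set G1 : Set (BondConfig V) := {ω | insert e ω ∈ G} with hG1d
    set a : ℝ := ((w e : unitInterval) : ℝ) with ha
    have ha0 : 0 ≤ a := (w e).2.1
    have ha1 : a ≤ 1 := (w e).2.2
    set Z := rcPartitionFunctionW w q ∅ with hZ
    set Z0 := rcPartitionFunctionW w0 q ∅ with hZ0
    set Z1 := rcPartitionFunctionW w1 q ∅ with hZ1
    have hZ0p : 0 < Z0 := rcPartitionFunctionW_pos w0 hq ∅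
    have hZ1p : 0 < Z1 := rcPartitionFunctionW_pos w1 hq ∅
    have I0 : (∑ ω : BondConfig V, rcWeightW w0 q ∅ ω * ind (F ∩ G) ω) * Z0 ≤
        (∑ ω : BondConfig V, rcWeightW w0 q ∅ ω * ind F ω) * (∑ ω : BondConfig V, rcWeightW w0 q ∅ ω * ind G ω) := by
      have h := ih S' hS'c hS'T w0 (hP0 w e hw) G0 (isUpperSet_sec_diff hG e) (determinedBy_sec_diff hGS e) (hQ0 S G e heS hGQ)
      have e1 := sum_rcWeightW_update_zero_sec w q e F G
      have e2 := sum_rcWeightW_update_zero_sec w q e Set.univ G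
      rw [Set.univ_inter, Set.univ_inter] at e2
      rw [e1, e2]; exact h
    by_cases hae0 : a = 0
    · have hwe : w0 = w := by
        rw [hw0]; exact Function.update_eq_self_iff.2 (Subtype.ext (by simpa [ha] using hae0.symm))
      rw [hwe] at I0; simpa [hZ0, hwe] using I0
    have I1 : (∑ ω : BondConfig V, rcWeightW w1 q ∅ ω * ind (F ∩ G) ω) * Z1 ≤
        (∑ ω : BondConfig V, rcWeightW w1 q ∅ ω * ind F ω) * (∑ ω : BondConfig V, rcWeightW w1 q ∅ ω * ind G ω) := by
      have h := ih S' hS'c hS'T w1 (hP1 w e hw hae0) G1 (isUpperSet_sec_insert hG e) (determinedBy_sec_insert hGS e)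
        (hQ1 S G e heS hGQ)
      have e1 := sum_rcWeightW_update_one_sec w q e F G
      have e2 := sum_rcWeightW_update_one_sec w q e Set.univ G
      rw [Set.univ_inter, Set.univ_inter] at e2
      rw [e1, e2]; exact h
    by_cases hae1 : a = 1
    · have hwe : w1 = w := by
        rw [hw1]; exact Function.update_eq_self_iff.2 (Subtype.ext (by simpa [ha] using hae1.symm))
      rw [hwe] at I1; simpa [hZ1, hwe] using I1
    have hapos : 0 < a := lt_of_le_of_ne ha0 (Ne.symm hae0)
    have ha1pos : 0 < 1 - a := by linarith [lt_of_le_of_ne ha1 hae1]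
    set C0 := ∑ ω : BondConfig V, rcWeightW w0 q ∅ ω * ind (F ∩ G) ω with hC0
    set C1 := ∑ ω : BondConfig V, rcWeightW w1 q ∅ ω * ind (F ∩ G) ω with hC1
    set F0 := ∑ ω : BondConfig V, rcWeightW w0 q ∅ ω * ind F ω with hF0
    set F1 := ∑ ω : BondConfig V, rcWeightW w1 q ∅ ω * ind F ω with hF1
    set M0 := ∑ ω : BondConfig V, rcWeightW w0 q ∅ ω * ind G ω with hM0
    set M1 := ∑ ω : BondConfig V, rcWeightW w1 q ∅ ω * ind G ω with hM1
    have dFG : ∑ ω : BondConfig V, rcWeightW w q ∅ ω * ind (F ∩ G) ω = (1 - a) * C0 + a * C1 :=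
      sum_rcWeightW_ind_affine w q e (F ∩ G)
    have dF : ∑ ω : BondConfig V, rcWeightW w q ∅ ω * ind F ω = (1 - a) * F0 + a * F1 := sum_rcWeightW_ind_affine w q e F
    have dG : ∑ ω : BondConfig V, rcWeightW w q ∅ ω * ind G ω = (1 - a) * M0 + a * M1 := sum_rcWeightW_ind_affine w q e G
    have dZ : Z = (1 - a) * Z0 + a * Z1 := rcPartitionFunctionW_affine w q e
    have dJ : ∑ ω : BondConfig V, rcWeightW w q ∅ ω * ind {ω | e ∈ ω} ω = a * Z1 := sum_rcWeightW_ind_openPair w q e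
    have dJF : ∑ ω : BondConfig V, rcWeightW w q ∅ ω * ind ({ω | e ∈ ω} ∩ F) ω = a * F1 := sum_rcWeightW_ind_inter_openPair w q e F
    have dJG : ∑ ω : BondConfig V, rcWeightW w q ∅ ω * ind ({ω | e ∈ ω} ∩ G) ω = a * M1 := sum_rcWeightW_ind_inter_openPair w q e G
    rw [dJF, dJ, dF, dZ] at hcd
    have hCD' : F1 * Z0 ≤ F0 * Z1 := by
      have h1 : a * (1 - a) * (F1 * Z0 - F0 * Z1) ≤ 0 := by linarith only [hcd]
      have h2 : F1 * Z0 - F0 * Z1 ≤ 0 := by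
        by_contra hcon
        have : 0 < a * (1 - a) * (F1 * Z0 - F0 * Z1) := mul_pos (mul_pos hapos ha1pos) (not_le.mp hcon)
        linarith only [this, h1]
      linarith only [h2]
    rw [dJG, dJ, dG, dZ] at hpe
    have hpiv' : M0 * Z1 ≤ M1 * Z0 := by
      have h1 : a * (1 - a) * (M0 * Z1 - M1 * Z0) ≤ 0 := by linarith only [hpe]
      have h2 : M0 * Z1 - M1 * Z0 ≤ 0 := by
        by_contra hcon
        have : 0 < a * (1 - a) * (M0 * Z1 - M1 * Z0) := mul_pos (mul_pos hapos ha1pos) (not_le.mp hcon)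
        linarith only [this, h1]
      linarith only [h2]
    have key : F0 * M0 * (Z1 * Z1) + F1 * M1 * (Z0 * Z0) ≤ (F0 * M1 + F1 * M0) * (Z0 * Z1) := by
      have h := mul_nonneg (sub_nonneg.2 hCD') (sub_nonneg.2 hpiv')
      have hx : (F0 * Z1 - F1 * Z0) * (M1 * Z0 - M0 * Z1) =
          (F0 * M1 + F1 * M0) * (Z0 * Z1) - (F0 * M0 * (Z1 * Z1) + F1 * M1 * (Z0 * Z0)) := by ring
      rw [hx] at h
      linarith only [h]
    have cross : C0 * Z1 + C1 * Z0 ≤ F0 * M1 + F1 * M0 := by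
      have h1 : C0 * Z0 * (Z1 * Z1) ≤ F0 * M0 * (Z1 * Z1) := mul_le_mul_of_nonneg_right I0 (mul_nonneg hZ1p.le hZ1p.le)
      have h2 : C1 * Z1 * (Z0 * Z0) ≤ F1 * M1 * (Z0 * Z0) := mul_le_mul_of_nonneg_right I1 (mul_nonneg hZ0p.le hZ0p.le)
      have h3 : (C0 * Z1 + C1 * Z0) * (Z0 * Z1) ≤ (F0 * M1 + F1 * M0) * (Z0 * Z1) := by
        have hx : (C0 * Z1 + C1 * Z0) * (Z0 * Z1) = C0 * Z0 * (Z1 * Z1) + C1 * Z1 * (Z0 * Z0) := by ring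
        rw [hx]; linarith only [h1, h2, key]
      exact le_of_mul_le_mul_right h3 (mul_pos hZ0p hZ1p)
    rw [dFG, dF, dG, dZ]
    have t0 : (1 - a) ^ 2 * (C0 * Z0) ≤ (1 - a) ^ 2 * (F0 * M0) := mul_le_mul_of_nonneg_left I0 (sq_nonneg _)
    have t1 : a ^ 2 * (C1 * Z1) ≤ a ^ 2 * (F1 * M1) := mul_le_mul_of_nonneg_left I1 (sq_nonneg _)
    have t2 : a * (1 - a) * (C0 * Z1 + C1 * Z0) ≤ a * (1 - a) * (F0 * M1 + F1 * M0) :=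
      mul_le_mul_of_nonneg_left cross (mul_nonneg hapos.le ha1pos.le)
    calc ((1 - a) * C0 + a * C1) * ((1 - a) * Z0 + a * Z1)
        = (1 - a) ^ 2 * (C0 * Z0) + a ^ 2 * (C1 * Z1) + a * (1 - a) * (C0 * Z1 + C1 * Z0) := by ring
      _ ≤ (1 - a) ^ 2 * (F0 * M0) + a ^ 2 * (F1 * M1) + a * (1 - a) * (F0 * M1 + F1 * M0) := by
          linarith only [t0, t1, t2]
      _ = ((1 - a) * F0 + a * F1) * ((1 - a) * M0 + a * M1) := by ring

/-! ### Positive-threshold events: the pivot property holds under every measure -/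

/-- **The pivot property is automatic for positive-threshold events.**  Let `S` be a nonempty finite set of pairs, `λ_e > 0` (`e ∈ S`),
`Λ(ω) = ∑_{e∈S} λ_e 1_{e∈ω}`, and let `G` satisfy `θ ≤ Λ` on `G` and `Λ ≤ θ` off `G`.  Then under `φ_{w,q}` (any `w`, any `q ≥ 0`; only
nonnegativity of the weights is used) some `e ∈ S` has `S(G)·S(J_e) ≤ S(J_e ∩ G)·Z`, i.e. `Cov(1_G, 1_{J_e}) ≥ 0`: indeed
`∑_e λ_e [S(J_e ∩ G)Z − S(G)S(J_e)] = S(1_G Λ)·S(Gᶜ) − S(G)·S(1_{Gᶜ}Λ) ≥ θS(G)S(Gᶜ) − θS(G)S(Gᶜ) = 0`.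
(Feder–Mihail use the case `Λ = |ω|` constant on the support of a uniform matroid measure.) [cite: FederMihail1992, Lemma 3.2, §3]
[cite: Pemantle2000, §1.5 (pp. 1379–1380)] -/
theorem exists_pivot_of_threshold (w : Sym2 V → unitInterval) {q : ℝ} (hq : 0 ≤ q) {S : Finset (Sym2 V)} (hS : S.Nonempty)
    (G : Set (BondConfig V)) (lam : Sym2 V → ℝ) (θ : ℝ) (hpos : ∀ e ∈ S, 0 < lam e)
    (hG1 : ∀ ω : BondConfig V, ω ∈ G → θ ≤ ∑ e ∈ S, lam e * ind {ω' : BondConfig V | e ∈ ω'} ω)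
    (hG0 : ∀ ω : BondConfig V, ω ∉ G → (∑ e ∈ S, lam e * ind {ω' : BondConfig V | e ∈ ω'} ω) ≤ θ) :
    ∃ e ∈ S, (∑ ω : BondConfig V, rcWeightW w q ∅ ω * ind G ω) *
        (∑ ω : BondConfig V, rcWeightW w q ∅ ω * ind {ω | e ∈ ω} ω) ≤
      (∑ ω : BondConfig V, rcWeightW w q ∅ ω * ind ({ω | e ∈ ω} ∩ G) ω) * rcPartitionFunctionW w q ∅ := by
  by_contra hcon
  push Not at hcon
  set μ : BondConfig V → ℝ := fun ω => rcWeightW w q ∅ ω with hμ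
  have hμ0 : ∀ ω, 0 ≤ μ ω := fun ω => rcWeightW_nonneg w hq ∅ ω
  set Λ : BondConfig V → ℝ := fun ω => ∑ e ∈ S, lam e * ind {ω' : BondConfig V | e ∈ ω'} ω with hΛ
  set MG := ∑ ω : BondConfig V, μ ω * ind G ω with hMG
  set MGc := ∑ ω : BondConfig V, μ ω * ind Gᶜ ω with hMGc
  set A := ∑ ω : BondConfig V, μ ω * ind G ω * Λ ω with hA
  set C := ∑ ω : BondConfig V, μ ω * ind Gᶜ ω * Λ ω with hC
  set Z := rcPartitionFunctionW w q ∅ with hZ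
  have hMG0 : 0 ≤ MG := Finset.sum_nonneg fun ω _ => mul_nonneg (hμ0 ω) (ind_nonneg G ω)
  have hMGc0 : 0 ≤ MGc := Finset.sum_nonneg fun ω _ => mul_nonneg (hμ0 ω) (ind_nonneg Gᶜ ω)
  -- `Z = S(G) + S(Gᶜ)`
  have hZsplit : Z = MG + MGc := by
    rw [hZ, hMG, hMGc, ← Finset.sum_add_distrib]
    unfold rcPartitionFunctionW
    refine Finset.sum_congr rfl fun ω _ => ?_
    by_cases h : ω ∈ G
    · rw [ind_of_mem h, ind_of_not_mem (Set.notMem_compl_iff.2 h)]; ring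
    · rw [ind_of_not_mem h, ind_of_mem (show ω ∈ Gᶜ from h)]; ring
  -- `S(Λ) = A + C`
  have hBsplit : ∑ ω : BondConfig V, μ ω * Λ ω = A + C := by
    rw [hA, hC, ← Finset.sum_add_distrib]
    refine Finset.sum_congr rfl fun ω _ => ?_
    by_cases h : ω ∈ G
    · rw [ind_of_mem h, ind_of_not_mem (Set.notMem_compl_iff.2 h)]; ring
    · rw [ind_of_not_mem h, ind_of_mem (show ω ∈ Gᶜ from h)]; ring
  -- `A ≥ θ S(G)` and `C ≤ θ S(Gᶜ)`
  have hAge : θ * MG ≤ A := by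
    rw [hMG, hA, Finset.mul_sum]
    refine Finset.sum_le_sum fun ω _ => ?_
    by_cases h : ω ∈ G
    · rw [ind_of_mem h]; simp only [mul_one]; rw [mul_comm]
      exact mul_le_mul_of_nonneg_left (hG1 ω h) (hμ0 ω)
    · rw [ind_of_not_mem h]; simp
  have hCle : C ≤ θ * MGc := by
    rw [hMGc, hC, Finset.mul_sum]
    refine Finset.sum_le_sum fun ω _ => ?_
    by_cases h : ω ∈ G
    · rw [ind_of_not_mem (Set.notMem_compl_iff.2 h)]; simp
    · rw [ind_of_mem (show ω ∈ Gᶜ from h)]; simp only [mul_one]; rw [mul_comm θ]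
      exact mul_le_mul_of_nonneg_left (hG0 ω h) (hμ0 ω)
  -- the weighted sum of the covariances, computed two ways
  have hsumJG : ∀ e ∈ S, ∑ ω : BondConfig V, μ ω * ind ({ω | e ∈ ω} ∩ G) ω =
      ∑ ω : BondConfig V, μ ω * ind G ω * ind {ω' : BondConfig V | e ∈ ω'} ω := by
    intro e _
    refine Finset.sum_congr rfl fun ω _ => ?_
    by_cases hJ : e ∈ ω
    · by_cases hG : ω ∈ G
      · rw [ind_of_mem (show ω ∈ ({ω | e ∈ ω} ∩ G : Set (BondConfig V)) from ⟨hJ, hG⟩), ind_of_mem hG,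
          ind_of_mem (show ω ∈ {ω' : BondConfig V | e ∈ ω'} from hJ)]; ring
      · rw [ind_of_not_mem (show ω ∉ ({ω | e ∈ ω} ∩ G : Set (BondConfig V)) from fun h => hG h.2), ind_of_not_mem hG]; ring
    · rw [ind_of_not_mem (show ω ∉ ({ω | e ∈ ω} ∩ G : Set (BondConfig V)) from fun h => hJ h.1),
        ind_of_not_mem (show ω ∉ {ω' : BondConfig V | e ∈ ω'} from hJ)]; ring
  have hL1 : ∑ e ∈ S, lam e * (∑ ω : BondConfig V, μ ω * ind ({ω | e ∈ ω} ∩ G) ω) = A := by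
    rw [hA]
    have : ∀ e ∈ S, lam e * (∑ ω : BondConfig V, μ ω * ind ({ω | e ∈ ω} ∩ G) ω) =
        ∑ ω : BondConfig V, μ ω * ind G ω * (lam e * ind {ω' : BondConfig V | e ∈ ω'} ω) := by
      intro e he
      rw [hsumJG e he, Finset.mul_sum]
      refine Finset.sum_congr rfl fun ω _ => ?_
      ring
    rw [Finset.sum_congr rfl this, Finset.sum_comm]
    refine Finset.sum_congr rfl fun ω _ => ?_
    rw [hΛ, Finset.mul_sum]
  have hL2 : ∑ e ∈ S, lam e * (∑ ω : BondConfig V, μ ω * ind {ω | e ∈ ω} ω) = ∑ ω : BondConfig V, μ ω * Λ ω := by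
    have : ∀ e ∈ S, lam e * (∑ ω : BondConfig V, μ ω * ind {ω | e ∈ ω} ω) =
        ∑ ω : BondConfig V, μ ω * (lam e * ind {ω' : BondConfig V | e ∈ ω'} ω) := by
      intro e _
      rw [Finset.mul_sum]
      refine Finset.sum_congr rfl fun ω _ => ?_
      ring
    rw [Finset.sum_congr rfl this, Finset.sum_comm]
    refine Finset.sum_congr rfl fun ω _ => ?_
    rw [hΛ, Finset.mul_sum]
  -- by assumption every term is negative
  have hneg : ∑ e ∈ S, lam e * ((∑ ω : BondConfig V, μ ω * ind ({ω | e ∈ ω} ∩ G) ω) * Z -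
      MG * (∑ ω : BondConfig V, μ ω * ind {ω | e ∈ ω} ω)) < 0 := by
    have h : ∀ e ∈ S, lam e * ((∑ ω : BondConfig V, μ ω * ind ({ω | e ∈ ω} ∩ G) ω) * Z -
        MG * (∑ ω : BondConfig V, μ ω * ind {ω | e ∈ ω} ω)) < 0 := by
      intro e he
      have h1 := hcon e he
      exact mul_neg_of_pos_of_neg (hpos e he) (by rw [hMG, hZ]; linarith only [h1])
    simpa using Finset.sum_lt_sum_of_nonempty hS h
  -- but the sum equals `A·Z − S(G)·S(Λ) ≥ 0`
  have hid : ∑ e ∈ S, lam e * ((∑ ω : BondConfig V, μ ω * ind ({ω | e ∈ ω} ∩ G) ω) * Z -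
      MG * (∑ ω : BondConfig V, μ ω * ind {ω | e ∈ ω} ω)) = A * Z - MG * (A + C) := by
    rw [← hBsplit, ← hL1, ← hL2, Finset.sum_mul, Finset.mul_sum, ← Finset.sum_sub_distrib]
    refine Finset.sum_congr rfl fun e _ => ?_
    ring
  have hge : 0 ≤ A * Z - MG * (A + C) := by
    rw [hZsplit]
    have h1 : θ * MG * MGc ≤ A * MGc := by
      have := mul_le_mul_of_nonneg_right hAge hMGc0; linarith only [this]
    have h2 : MG * C ≤ MG * (θ * MGc) := mul_le_mul_of_nonneg_left hCle hMG0
    nlinarith only [h1, h2]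
  rw [hid] at hneg
  exact absurd hge (not_le.2 hneg)

/-! ### Sections of threshold events are threshold events -/

omit [Fintype V] in
/-- `Λ_S(insert e ω) = λ_e + Λ_{S ∖ e}(ω)` for `e ∈ S`. [folklore] -/
theorem thresholdSum_insert {S : Finset (Sym2 V)} {e : Sym2 V} (he : e ∈ S) (lam : Sym2 V → ℝ) (ω : BondConfig V) :
    ∑ f ∈ S, lam f * ind {ω' : BondConfig V | f ∈ ω'} (insert e ω) =
      lam e + ∑ f ∈ S.erase e, lam f * ind {ω' : BondConfig V | f ∈ ω'} ω := by
  rw [← Finset.add_sum_erase S _ he, ind_of_mem (show insert e ω ∈ {ω' : BondConfig V | e ∈ ω'} from Set.mem_insert e ω),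
    mul_one]
  congr 1
  refine Finset.sum_congr rfl fun f hf => ?_
  have hfe : f ≠ e := (Finset.mem_erase.1 hf).1
  by_cases h : f ∈ ω
  · rw [ind_of_mem (show insert e ω ∈ {ω' : BondConfig V | f ∈ ω'} from Set.mem_insert_of_mem e h),
      ind_of_mem (show ω ∈ {ω' : BondConfig V | f ∈ ω'} from h)]
  · rw [ind_of_not_mem (show insert e ω ∉ {ω' : BondConfig V | f ∈ ω'} from fun h' => ?_),
      ind_of_not_mem (show ω ∉ {ω' : BondConfig V | f ∈ ω'} from h)]
    rcases (Set.mem_insert_iff.1 h') with h'' | h''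
    · exact hfe h''
    · exact h h''

omit [Fintype V] in
/-- `Λ_S(ω ∖ {e}) = Λ_{S ∖ e}(ω)` for `e ∈ S`. [folklore] -/
theorem thresholdSum_diff {S : Finset (Sym2 V)} {e : Sym2 V} (he : e ∈ S) (lam : Sym2 V → ℝ) (ω : BondConfig V) :
    ∑ f ∈ S, lam f * ind {ω' : BondConfig V | f ∈ ω'} (ω \ {e}) =
      ∑ f ∈ S.erase e, lam f * ind {ω' : BondConfig V | f ∈ ω'} ω := by
  rw [← Finset.add_sum_erase S _ he,
    ind_of_not_mem (show ω \ {e} ∉ {ω' : BondConfig V | e ∈ ω'} from fun h => h.2 rfl), mul_zero, zero_add]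
  refine Finset.sum_congr rfl fun f hf => ?_
  have hfe : f ≠ e := (Finset.mem_erase.1 hf).1
  by_cases h : f ∈ ω
  · rw [ind_of_mem (show ω \ {e} ∈ {ω' : BondConfig V | f ∈ ω'} from ⟨h, hfe⟩),
      ind_of_mem (show ω ∈ {ω' : BondConfig V | f ∈ ω'} from h)]
  · rw [ind_of_not_mem (show ω \ {e} ∉ {ω' : BondConfig V | f ∈ ω'} from fun h' => h h'.1),
      ind_of_not_mem (show ω ∉ {ω' : BondConfig V | f ∈ ω'} from h)]

end FK

end Summit.CriticalPhenomena.PercolationContinuityZ3.Theorems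

end
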